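import Summits.QuantumFields.YangMills.Theorems.BalabanUVNodesN27AtRecord12Home
import Summits.QuantumFields.YangMills.Theorems.BalabanUVNodesN27KeyedKnitWorldFree
import Summits.QuantumFields.YangMills.Theorems.BalabanUVNodesRateCarriersOfRecord12On
import Literature.MathematicalPhysics.QuantumFieldTheory.Balaban1983to89.Node00.Record12DatumKeyCN

/-!
# BalabanUVNodes ∕ N27 = binder B5 AT THE RECORD, XXVIII — N27 AT THE REGIME-RESTRICTED STAGE-12 CARRIER HOMES: B5 from the one-application stub instances at
# (T-SPINE)₁₂ `YMDAG.UVSplit.SRec₁₂On cr Rg` (dag-n20-d, `…SpineCarriersOfRecord12` §4) and (T-RATE)₁₂ `YMDAG.UVSplit.RRec₁₂On 𝔯 Rg` (dag-n22-e, `…RateCarriersOfRecord12On`) —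
# BOTH READ AT THE TUPLE θ ITSELF, RESTRICTED TO AN ARBITRARY REGIME `Rg F θ` — and the SAME-TUPLE, ALL-RUN-LENGTHS N19′ edge; K4's hook in the ∀-packaging
# `RateInputsAll (RRec₁₂On 𝔯 Rg)`, so that NO canonical parameter, NO pair-form edge and NO existence stub `S_R00x` is read
# (cell `pub-ymgap`, HUMAN RULING D-0062 Track A, R134 seat `pub-ymgap-dag-n27-c` (s2) gen 3; `--supports` the K3′ item `SpineGivenEndpointR12` stmt-QuantumFields-19908 (rev 15,
# dag-lead WORDS-111 key table) `--as helper`; COUNT-NEUTRAL; `N`-generic, regime-generic, record-class-generic, NO Theses import — the route-facing `N = 2` line at the rev-15 guard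
# `Rg F θ := θ.ZtUnity F 2 ∧ θ.SlotsNondegenerate` is module XXVI's `spineGivenEndpointR12_of_homes₁₂On`)

WHY.  Module XXVII knits B5 at the CANONICALLY keyed homes `SRec₁₂ cr` ∕ `RRec₁₂ 𝔯`: its N19′ edge reads the rate bundle at `h.params := Classical.choose h`, SOME admissible tuple with
provisos realising the spine bundle's datum — dag-ref-H XXVII-PRE-READ-NOTE (pub-ymgap INBOX l.13791): after rev 15 the items K2′∕K3′ GUARD the tuple («`(θ.ZtUnity F 2 ∧
θ.SlotsNondegenerate) →`») and a guard on θ does NOT reach `h.params`; honest shape (b) = «state the rate stubs with the guard INSIDE and read them AT θ».  The two carrier homes now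
export exactly that: the TUPLE-keyed, REGIME-restricted predicates `SRec₁₂On cr Rg` (p466448 §4) and `RRec₁₂On 𝔯 Rg` (p468431) with their guarded θ-form faces.  THIS MODULE is N27's
knit at them.  The junction is CLEANER than at the canonical homes: a bundle pinned by `SRec₁₂On cr Rg` at `D` is `cr F θ hP g₀ os` for a tuple θ IN THE REGIME realising `D`, and K4's
∀-hook `RateInputsAll (RRec₁₂On 𝔯 Rg) F D g₀ os` delivers the six rates at EVERY bundle pinned at `D` — in particular at every run length of the rate reading AT THAT SAME θ
(`rRec₁₂On_self`).  So the edge XII `spine_of_coreEdge` consumes follows from the SAME-TUPLE edge «at every guarded admissible θ, the rates at all run lengths of `rateCarriersOfRecord₁₂ 𝔯 F θ hP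
g₀ os ·` on θ's datum give SOME summable `δ` carrying `Spine.NE7.Core` on the shell-free cores of `cr F θ hP g₀ os`» — no pair of tuples (XXII∕XXIV `h19₂`), no datum-determined reading
(XXIV `pairEdge_of_datumDetermined`), no `Classical.choose`; and with the ∀-hook K4 needs NO existence stub (`SpineRates_of_forall`), so `S_R00x` is not even mentioned.

WHAT IS KERNEL-CHECKED ([bookkeeping]; 0 `def`, 0 `sorry`; every stub ∕ face ∕ edge a HYPOTHESIS — 0∕1 at every record today).
* §0 `sRec₁₂On_iff_bundled` — (T-SPINE)'s regime home IS XXIV's characterised spine record at the BUNDLED key `Adm' θ := Rg F θ ∧ θ.Admissible F N` (the rate home is NOT of XXIV's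
  single-bundle shape — it pins every run length — whence the ∀-hook road below).
* §1 `coreEdge_of_homes₁₂On` — the edge XII consumes at `(SRec₁₂On cr Rg, Inputs := RateInputsAll (RRec₁₂On 𝔯 Rg))` from the same-tuple all-run-lengths guarded edge `h19`;
  `spineRates_rRec₁₂On_of_keyedRates` — K4's ∀-hook at the regime home from the guarded θ-form of the six rates (any record class).
* §2 `spine_of_homes₁₂On` — for ANY record class `Rec`: the six K4 stubs at `RRec₁₂On 𝔯 Rg` · `S_N27x Rec (SRec₁₂On cr Rg)` · `S_N20`, `S_N21` at `SRec₁₂On cr Rg` · `h19` ⇒ `Spine Rec`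
  (XII `spine_of_coreEdge` ∘ `SpineRates_of_forall`); `spine_of_homes₁₂On_faces` — the same with the rates and N20∕N21 in guarded θ-form.
* §3 the regime-keyed datum class `fun F D _ => ∃ θ h, (Rg F θ ∧ θ.Admissible F N) ∧ D = datumOfRecord₁₂ F N θ h` (XXIVb's keyed-datum class at the bundled key; world not read):
  `s_N27x_recOn₁₂_of_keyed` (N27x there from the guarded keyed extraction clause, XXIV `s_N27x_keyed_of`) · **`forall_guarded₁₂_of_homes₁₂On`** — «∀ F θ hP, Rg F θ → θ.Admissible F N →
  HybridNE7Under (datumOfRecord₁₂ F N θ hP) END» from the stubs at the two regime homes, the guarded keyed extraction clause and `h19` (XXIVb `spine_keyedClass_iff_forall_keyed`) — THE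
  GUARD REACHES EVERY HYPOTHESIS · `forall_guarded₁₂_of_homes₁₂On_faces` (all θ-forms).
* §4 `spine_rec12C_of_homes₁₂On_true` — the trivial regime and `Rec := Node00.IsRecordOfRecord₁₂C F N`: module XXVII's conclusion `Spine ₁₂C` with nothing read at a canonical parameter
  (the stubs at `RRec₁₂On 𝔯 ⊤` are STRONGER than at `RRec₁₂ 𝔯` — n22-e `k4_rRec₁₂_of_rRec₁₂On_true` — the edge WEAKER than XXVII's: same tuple only).

HONEST FRAMING.  COMPOSITE-node bookkeeping: every K4∕K5 stub, the extraction clause and the edge are HYPOTHESES with NO producer at any record today (0∕1); the readings `cr`, `𝔯`, the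
regime `Rg` and the record class `Rec` are PARAMETERS (no reading of Bałaban's dressed expansion ∕ dressed tower of record exists — dag-n20-e LOCATED (F1)–(F4), RR-1's residual `𝔱`);
inhabitation of any regime class is K0′ `Record12Inhabited` (stmt-QuantumFields-19902, open) and is NOT used or claimed; nothing of Bałaban's asserted; NE7 ∕ NE7b ∕ NE7c NOT PRINTED for
d = 4 and NOT PROVED; NO node discharged; K3′ NOT claimed; counts UNMOVED (typed 28∕28 · discharged 5∕27, A 5∕28); one finite four-torus programme at fixed `ε` — NOT ℝ⁴, NOT infinite
volume, NOT OS, NOT a mass gap, NOT Clay.  No decl below carries a cite tag.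
-/

namespace Summit.QuantumFields.YangMills.Theorems.BalabanUVNodesN27SpineRecord

open Literature.MathematicalPhysics.QuantumFieldTheory.Balaban1983to89
open Literature.MathematicalPhysics.QuantumFieldTheory.Balaban1983to89.T4Continuum
open T4WeightBudget (RelWeightBound)
open T4IndicatorShell (ShellWeightBound)
open T4ContinuumYM4Torus (ForSmallCouplings)
open Summit.QuantumFields.BalabanUV.T4Continuum.Spine
open YMDAG.UVSplit
open Node00 (Stage12Params datumOfRecord₁₂ IsRecordOfRecord₁₂C)

variable {N : ℕ} [NeZero N] (cr : SpineReading₁₂ N) (𝔯 : RateReading₁₂ N) (Rg : (F : T4Family) → Stage12Params F N → Prop)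

/-! ## §0 The regime home on the spine side is a characterised record at the bundled key -/

/-- **(T-SPINE)'s REGIME HOME IS XXIV's CHARACTERISED SPINE RECORD AT THE BUNDLED KEY** `Adm' θ := Rg F θ ∧ θ.Admissible F N` (`sRec₁₂On_iff` is `Iff.rfl`; only the two
conjuncts are re-bracketed). [bookkeeping] -/
theorem sRec₁₂On_iff_bundled {F : T4Family} (D : Datum F N) (g₀ : ℕ → ℝ) (os : List (ULoop F)) (S : SpineCarriers) :
    SRec₁₂On cr Rg F D g₀ os S ↔
      ∃ (θ : Stage12Params F N) (h : θ.Provisos₁₂ F N), (Rg F θ ∧ θ.Admissible F N) ∧ D = datumOfRecord₁₂ F N θ h ∧ S = cr F θ h g₀ os :=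
  ⟨fun ⟨θ, h, hRg, hθ, hD, hS⟩ => ⟨θ, h, ⟨hRg, hθ⟩, hD, hS⟩, fun ⟨θ, h, hA, hD, hS⟩ => ⟨θ, h, hA.1, hA.2, hD, hS⟩⟩

/-! ## §1 The N19′ edge at the regime-restricted homes with K4's ∀-hook; the ∀-hook from the guarded θ-form of the rates -/

/-- **XII's N19′ EDGE AT `(SRec₁₂On cr Rg, Inputs := RateInputsAll (RRec₁₂On 𝔯 Rg))` FROM THE SAME-TUPLE, ALL-RUN-LENGTHS, GUARDED EDGE.**  A bundle pinned by the regime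
home at `D` is `cr F θ hP g₀ os` for an admissible θ with provisos IN THE REGIME realising `D`; K4's ∀-hook at `D` gives the six rates at every bundle the rate home pins at `D`, in
particular at every run length `k` of `rateCarriersOfRecord₁₂ 𝔯 F θ hP g₀ os k` — read AT THE SAME θ (`rRec₁₂On_self`); so the same-tuple edge `h19` is all XII needs.  No pair of tuples,
no canonical parameter. [bookkeeping] -/
theorem coreEdge_of_homes₁₂On
    (h19 : ∀ (F : T4Family) (θ : Stage12Params F N) (hP : θ.Provisos₁₂ F N), Rg F θ → θ.Admissible F N → ∀ (g₀ : ℕ → ℝ) (os : List (ULoop F)),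
      (∀ k : ℕ, RatesAt (datumOfRecord₁₂ F N θ hP) (rateCarriersOfRecord₁₂ 𝔯 F θ hP g₀ os k)) → letI := (cr F θ hP g₀ os).dec
        ∃ δ : ℕ → ℝ, NE7.Core (cr F θ hP g₀ os).l₀ (cr F θ hP g₀ os).vol (cr F θ hP g₀ os).T (cr F θ hP g₀ os).Bad
          (fun K t τ => (cr F θ hP g₀ os).A K t τ - (cr F θ hP g₀ os).shA K t τ) (fun K t τ => (cr F θ hP g₀ os).B K t τ - (cr F θ hP g₀ os).shB K t τ) δ ∧
          Summable δ)
    (F : T4Family) (D : Datum F N) (g₀ : ℕ → ℝ) (os : List (ULoop F)) (S : SpineCarriers) (hS : SRec₁₂On cr Rg F D g₀ os S)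
    (hin : RateInputsAll (RRec₁₂On 𝔯 Rg) F D g₀ os) : letI := S.dec
      ∃ δ : ℕ → ℝ, NE7.Core S.l₀ S.vol S.T S.Bad (fun K t τ => S.A K t τ - S.shA K t τ) (fun K t τ => S.B K t τ - S.shB K t τ) δ ∧ Summable δ := by
  obtain ⟨θ, hP, hRg, hθ, rfl, rfl⟩ := hS
  exact h19 F θ hP hRg hθ g₀ os fun k => hin _ (rRec₁₂On_self 𝔯 Rg θ hP hRg hθ g₀ os k)

/-- **K4's ∀-HOOK AT THE REGIME HOME FROM THE GUARDED θ-FORM OF THE SIX RATES** (any record class; thresholds trivial, `ForSmallCouplings.of_forall`): «at every admissible θ with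
provisos in the regime, every `g₀`, `os`, `k`, `RatesAt (datumOfRecord₁₂ F N θ hP) (rateCarriersOfRecord₁₂ 𝔯 F θ hP g₀ os k)`» (e.g. n22-e `ratesAt_of_k4_rRec₁₂On` from the six stubs)
gives `SpineRates Rec (RateInputsAll (RRec₁₂On 𝔯 Rg))`. [bookkeeping] -/
theorem spineRates_rRec₁₂On_of_keyedRates (Rec : RecordPred N)
    (hrates : ∀ (F : T4Family) (θ : Stage12Params F N) (hP : θ.Provisos₁₂ F N), Rg F θ → θ.Admissible F N → ∀ (g₀ : ℕ → ℝ) (os : List (ULoop F)) (k : ℕ),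
      RatesAt (datumOfRecord₁₂ F N θ hP) (rateCarriersOfRecord₁₂ 𝔯 F θ hP g₀ os k)) :
    SpineRates Rec (RateInputsAll (RRec₁₂On 𝔯 Rg)) := by
  intro F D w _ _ _
  refine ForSmallCouplings.of_forall fun g₀ os R hR => ?_
  obtain ⟨θ, hP, hRg, hθ, rfl, k, rfl⟩ := hR
  exact hrates F θ hP hRg hθ g₀ os k

/-! ## §2 The knit at the regime-restricted homes, for any record class -/

/-- **N27 = B5 AT ANY RECORD CLASS FROM THE STUB INSTANCES OF THE TWO REGIME-RESTRICTED CARRIER HOMES AND THE SAME-TUPLE EDGE — `S_R00x` NOT ASKED.**  XII `spine_of_coreEdge` at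
`(Rec, SRec₁₂On cr Rg, RateInputsAll (RRec₁₂On 𝔯 Rg))`: the six K4 stubs at `RRec₁₂On 𝔯 Rg` (K4's ∀-hook by `SpineRates_of_forall` — no existence needed), the three K5 stubs at
`SRec₁₂On cr Rg` (`S_N27x` links `Rec` to the regime: at every record of `Rec` the extraction witness is pinned IN the regime) and `h19` (§1) give `Spine Rec`.  Every stub a HYPOTHESIS
(0∕1 today). [bookkeeping] -/
theorem spine_of_homes₁₂On (Rec : RecordPred N) (h14 : S_N14 (RRec₁₂On 𝔯 Rg)) (h15 : S_N15 (RRec₁₂On 𝔯 Rg)) (h16 : S_N16 (RRec₁₂On 𝔯 Rg))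
    (h17 : S_N17 (RRec₁₂On 𝔯 Rg)) (h18 : S_N18 (RRec₁₂On 𝔯 Rg)) (h22 : S_N22 (RRec₁₂On 𝔯 Rg)) (hx' : S_N27x Rec (SRec₁₂On cr Rg))
    (h20 : S_N20 (SRec₁₂On cr Rg)) (h21 : S_N21 (SRec₁₂On cr Rg))
    (h19 : ∀ (F : T4Family) (θ : Stage12Params F N) (hP : θ.Provisos₁₂ F N), Rg F θ → θ.Admissible F N → ∀ (g₀ : ℕ → ℝ) (os : List (ULoop F)),
      (∀ k : ℕ, RatesAt (datumOfRecord₁₂ F N θ hP) (rateCarriersOfRecord₁₂ 𝔯 F θ hP g₀ os k)) → letI := (cr F θ hP g₀ os).dec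
        ∃ δ : ℕ → ℝ, NE7.Core (cr F θ hP g₀ os).l₀ (cr F θ hP g₀ os).vol (cr F θ hP g₀ os).T (cr F θ hP g₀ os).Bad
          (fun K t τ => (cr F θ hP g₀ os).A K t τ - (cr F θ hP g₀ os).shA K t τ) (fun K t τ => (cr F θ hP g₀ os).B K t τ - (cr F θ hP g₀ os).shB K t τ) δ ∧
          Summable δ) :
    Spine Rec :=
  spine_of_coreEdge Rec (SRec₁₂On cr Rg) (RateInputsAll (RRec₁₂On 𝔯 Rg)) hx' h20 h21 (coreEdge_of_homes₁₂On cr 𝔯 Rg h19)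
    (SpineRates_of_forall Rec (RRec₁₂On 𝔯 Rg) h14 h15 h16 h17 h18 h22)

/-- **THE SAME WITH THE RATES AND THE SPINE-SIDE STUBS IN GUARDED θ-FORM**: the six rates jointly at every run length of the rate reading (`hrates`, §1
`spineRates_rRec₁₂On_of_keyedRates`), N20 `RelWeightBound` ∕ N21 `ShellWeightBound` at `cr F θ hP g₀ os` — each asked ONLY of admissible tuples with provisos IN THE REGIME
((T-SPINE) `s_N20_sRec₁₂On_iff`; N21 unfolded here) — `S_N27x Rec (SRec₁₂On cr Rg)` and `h19`. [bookkeeping] -/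
theorem spine_of_homes₁₂On_faces (Rec : RecordPred N)
    (hrates : ∀ (F : T4Family) (θ : Stage12Params F N) (hP : θ.Provisos₁₂ F N), Rg F θ → θ.Admissible F N → ∀ (g₀ : ℕ → ℝ) (os : List (ULoop F)) (k : ℕ),
      RatesAt (datumOfRecord₁₂ F N θ hP) (rateCarriersOfRecord₁₂ 𝔯 F θ hP g₀ os k))
    (hx' : S_N27x Rec (SRec₁₂On cr Rg))
    (h20 : ∀ (F : T4Family) (θ : Stage12Params F N) (hP : θ.Provisos₁₂ F N), Rg F θ → θ.Admissible F N → ∀ (g₀ : ℕ → ℝ) (os : List (ULoop F)),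
      RelWeightBound (cr F θ hP g₀ os).l₀ (cr F θ hP g₀ os).T (cr F θ hP g₀ os).A (cr F θ hP g₀ os).B (cr F θ hP g₀ os).Bad (cr F θ hP g₀ os).W)
    (h21 : ∀ (F : T4Family) (θ : Stage12Params F N) (hP : θ.Provisos₁₂ F N), Rg F θ → θ.Admissible F N → ∀ (g₀ : ℕ → ℝ) (os : List (ULoop F)),
      ShellWeightBound (cr F θ hP g₀ os).l₀ (cr F θ hP g₀ os).T (cr F θ hP g₀ os).A (cr F θ hP g₀ os).B (cr F θ hP g₀ os).shA (cr F θ hP g₀ os).shB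
        (cr F θ hP g₀ os).Wsh)
    (h19 : ∀ (F : T4Family) (θ : Stage12Params F N) (hP : θ.Provisos₁₂ F N), Rg F θ → θ.Admissible F N → ∀ (g₀ : ℕ → ℝ) (os : List (ULoop F)),
      (∀ k : ℕ, RatesAt (datumOfRecord₁₂ F N θ hP) (rateCarriersOfRecord₁₂ 𝔯 F θ hP g₀ os k)) → letI := (cr F θ hP g₀ os).dec
        ∃ δ : ℕ → ℝ, NE7.Core (cr F θ hP g₀ os).l₀ (cr F θ hP g₀ os).vol (cr F θ hP g₀ os).T (cr F θ hP g₀ os).Bad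
          (fun K t τ => (cr F θ hP g₀ os).A K t τ - (cr F θ hP g₀ os).shA K t τ) (fun K t τ => (cr F θ hP g₀ os).B K t τ - (cr F θ hP g₀ os).shB K t τ) δ ∧
          Summable δ) :
    Spine Rec := by
  refine spine_of_coreEdge Rec (SRec₁₂On cr Rg) (RateInputsAll (RRec₁₂On 𝔯 Rg)) hx' ((s_N20_sRec₁₂On_iff cr Rg).mpr h20) ?_
    (coreEdge_of_homes₁₂On cr 𝔯 Rg h19) (spineRates_rRec₁₂On_of_keyedRates 𝔯 Rg Rec hrates)
  rintro F D g₀ os S ⟨θ, hP, hRg, hθ, -, rfl⟩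
  exact h21 F θ hP hRg hθ g₀ os

/-! ## §3 The regime-keyed datum class and the world-free guarded form «∀ θ h, Rg θ → Adm θ → B5 at the datum» -/

/-- **N27x AT THE REGIME-KEYED DATUM CLASS FROM THE GUARDED KEYED EXTRACTION CLAUSE** (XXIV `s_N27x_keyed_of` at the bundled key; (K1) is the identity): if at every admissible θ with
provisos IN THE REGIME, under (B) and END at its datum, for all small tuned `g₀` and every `os`, the reading `cr F θ hP g₀ os` has `0 < l₀`, `0 < vol` and satisfies the E1∕E2 dictionary
against the datum's dressed partition functions, then `S_N27x` holds at the class `fun F D _ => ∃ θ h, (Rg F θ ∧ θ.Admissible F N) ∧ D = datumOfRecord₁₂ F N θ h` for `SRec₁₂On cr Rg`.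
[bookkeeping] -/
theorem s_N27x_recOn₁₂_of_keyed
    (hx : ∀ (F : T4Family) (θ : Stage12Params F N) (hP : θ.Provisos₁₂ F N), Rg F θ → θ.Admissible F N →
      B16.EndStatementBPrinted (datumOfRecord₁₂ F N θ hP).C → DagBinding.EndpointExistence (datumOfRecord₁₂ F N θ hP).C.toB12 →
        ForSmallCouplings (datumOfRecord₁₂ F N θ hP) fun g₀ => ∀ os : List (ULoop F),
          0 < (cr F θ hP g₀ os).l₀ ∧ 0 < (cr F θ hP g₀ os).vol ∧
          (∀ (K : ℕ) (t : ℝ), |t| ≤ (cr F θ hP g₀ os).l₀ →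
            T4GenFunBounds.schemeZ ((datumOfRecord₁₂ F N θ hP).scheme g₀) os ((cr F θ hP g₀ os).K₀ + K) t =
              ∑ τ ∈ (cr F θ hP g₀ os).T K, (cr F θ hP g₀ os).A K t τ) ∧
          (∀ (K : ℕ) (t : ℝ), |t| ≤ (cr F θ hP g₀ os).l₀ →
            T4GenFunBounds.schemeZ ((datumOfRecord₁₂ F N θ hP).scheme g₀) os ((cr F θ hP g₀ os).K₀ + K + 1) t =
              ∑ τ ∈ (cr F θ hP g₀ os).T K, (cr F θ hP g₀ os).B K t τ)) :
    S_N27x (fun F D _ => ∃ (θ : Stage12Params F N) (h : θ.Provisos₁₂ F N), (Rg F θ ∧ θ.Admissible F N) ∧ D = datumOfRecord₁₂ F N θ h) (SRec₁₂On cr Rg) :=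
  s_N27x_keyed_of (Θ := fun F => Stage12Params F N) (fun θ => θ.Provisos₁₂ _ N) (fun θ => Rg _ θ ∧ θ.Admissible _ N) (fun θ h => datumOfRecord₁₂ _ N θ h) _
    (SRec₁₂On cr Rg) (fun θ h => cr _ θ h) (fun _ _ _ hR => hR) (fun _ D g₀ os S => sRec₁₂On_iff_bundled cr Rg D g₀ os S)
    fun F θ hP hA => hx F θ hP hA.1 hA.2

/-- **THE WORLD-FREE GUARDED B5 FROM THE TWO REGIME-RESTRICTED HOMES — THE GUARD REACHES EVERY HYPOTHESIS.**  For any regime `Rg`: the six K4 stubs at `RRec₁₂On 𝔯 Rg` (each IS its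
node's estimate asked only of admissible tuples IN THE REGIME, read at θ — n22-e `s_N1x_rRec₁₂On_iff`), the K5 stubs `S_N20`, `S_N21` at `SRec₁₂On cr Rg` (likewise, (T-SPINE) §4), the
guarded keyed extraction clause `hx` and the same-tuple all-run-lengths guarded edge `h19` give «for every admissible Stage-12 θ with provisos IN THE REGIME,
`HybridNE7Under (datumOfRecord₁₂ F N θ hP) END`» (§2 at the regime-keyed datum class, XXIVb `spine_keyedClass_iff_forall_keyed` at the bundled key).  At `N = 2`,
`Rg F θ := θ.ZtUnity F 2 ∧ θ.SlotsNondegenerate`, this is K3′ up to its two displayed antecedents (module XXVI).  Every hypothesis 0∕1 today. [bookkeeping] -/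
theorem forall_guarded₁₂_of_homes₁₂On (h14 : S_N14 (RRec₁₂On 𝔯 Rg)) (h15 : S_N15 (RRec₁₂On 𝔯 Rg)) (h16 : S_N16 (RRec₁₂On 𝔯 Rg))
    (h17 : S_N17 (RRec₁₂On 𝔯 Rg)) (h18 : S_N18 (RRec₁₂On 𝔯 Rg)) (h22 : S_N22 (RRec₁₂On 𝔯 Rg)) (h20 : S_N20 (SRec₁₂On cr Rg)) (h21 : S_N21 (SRec₁₂On cr Rg))
    (hx : ∀ (F : T4Family) (θ : Stage12Params F N) (hP : θ.Provisos₁₂ F N), Rg F θ → θ.Admissible F N →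
      B16.EndStatementBPrinted (datumOfRecord₁₂ F N θ hP).C → DagBinding.EndpointExistence (datumOfRecord₁₂ F N θ hP).C.toB12 →
        ForSmallCouplings (datumOfRecord₁₂ F N θ hP) fun g₀ => ∀ os : List (ULoop F),
          0 < (cr F θ hP g₀ os).l₀ ∧ 0 < (cr F θ hP g₀ os).vol ∧
          (∀ (K : ℕ) (t : ℝ), |t| ≤ (cr F θ hP g₀ os).l₀ →
            T4GenFunBounds.schemeZ ((datumOfRecord₁₂ F N θ hP).scheme g₀) os ((cr F θ hP g₀ os).K₀ + K) t =
              ∑ τ ∈ (cr F θ hP g₀ os).T K, (cr F θ hP g₀ os).A K t τ) ∧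
          (∀ (K : ℕ) (t : ℝ), |t| ≤ (cr F θ hP g₀ os).l₀ →
            T4GenFunBounds.schemeZ ((datumOfRecord₁₂ F N θ hP).scheme g₀) os ((cr F θ hP g₀ os).K₀ + K + 1) t =
              ∑ τ ∈ (cr F θ hP g₀ os).T K, (cr F θ hP g₀ os).B K t τ))
    (h19 : ∀ (F : T4Family) (θ : Stage12Params F N) (hP : θ.Provisos₁₂ F N), Rg F θ → θ.Admissible F N → ∀ (g₀ : ℕ → ℝ) (os : List (ULoop F)),
      (∀ k : ℕ, RatesAt (datumOfRecord₁₂ F N θ hP) (rateCarriersOfRecord₁₂ 𝔯 F θ hP g₀ os k)) → letI := (cr F θ hP g₀ os).dec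
        ∃ δ : ℕ → ℝ, NE7.Core (cr F θ hP g₀ os).l₀ (cr F θ hP g₀ os).vol (cr F θ hP g₀ os).T (cr F θ hP g₀ os).Bad
          (fun K t τ => (cr F θ hP g₀ os).A K t τ - (cr F θ hP g₀ os).shA K t τ) (fun K t τ => (cr F θ hP g₀ os).B K t τ - (cr F θ hP g₀ os).shB K t τ) δ ∧
          Summable δ)
    (F : T4Family) (θ : Stage12Params F N) (hP : θ.Provisos₁₂ F N) (hRg : Rg F θ) (hθ : θ.Admissible F N) :
    T4ApexHybrid.HybridNE7Under (datumOfRecord₁₂ F N θ hP) (DagBinding.EndpointExistence (datumOfRecord₁₂ F N θ hP).C.toB12) :=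
  (spine_keyedClass_iff_forall_keyed (Θ := fun F => Stage12Params F N) (fun θ => θ.Provisos₁₂ _ N) (fun θ => Rg _ θ ∧ θ.Admissible _ N)
      (fun θ h => datumOfRecord₁₂ _ N θ h)).mp
    (spine_of_homes₁₂On cr 𝔯 Rg _ h14 h15 h16 h17 h18 h22 (s_N27x_recOn₁₂_of_keyed cr Rg hx) h20 h21 h19) F θ hP ⟨hRg, hθ⟩

/-- **THE SAME WITH EVERY STUB IN ITS GUARDED θ-FORM** (§2 `spine_of_homes₁₂On_faces` at the regime-keyed datum class): the six rates at every run length of the rate reading, N20 ∕ N21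
at the spine reading, the extraction clause and the edge — all asked ONLY of admissible tuples with provisos in the regime ⇒ B5 at every such tuple's datum. [bookkeeping] -/
theorem forall_guarded₁₂_of_homes₁₂On_faces
    (hrates : ∀ (F : T4Family) (θ : Stage12Params F N) (hP : θ.Provisos₁₂ F N), Rg F θ → θ.Admissible F N → ∀ (g₀ : ℕ → ℝ) (os : List (ULoop F)) (k : ℕ),
      RatesAt (datumOfRecord₁₂ F N θ hP) (rateCarriersOfRecord₁₂ 𝔯 F θ hP g₀ os k))
    (h20 : ∀ (F : T4Family) (θ : Stage12Params F N) (hP : θ.Provisos₁₂ F N), Rg F θ → θ.Admissible F N → ∀ (g₀ : ℕ → ℝ) (os : List (ULoop F)),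
      RelWeightBound (cr F θ hP g₀ os).l₀ (cr F θ hP g₀ os).T (cr F θ hP g₀ os).A (cr F θ hP g₀ os).B (cr F θ hP g₀ os).Bad (cr F θ hP g₀ os).W)
    (h21 : ∀ (F : T4Family) (θ : Stage12Params F N) (hP : θ.Provisos₁₂ F N), Rg F θ → θ.Admissible F N → ∀ (g₀ : ℕ → ℝ) (os : List (ULoop F)),
      ShellWeightBound (cr F θ hP g₀ os).l₀ (cr F θ hP g₀ os).T (cr F θ hP g₀ os).A (cr F θ hP g₀ os).B (cr F θ hP g₀ os).shA (cr F θ hP g₀ os).shB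
        (cr F θ hP g₀ os).Wsh)
    (hx : ∀ (F : T4Family) (θ : Stage12Params F N) (hP : θ.Provisos₁₂ F N), Rg F θ → θ.Admissible F N →
      B16.EndStatementBPrinted (datumOfRecord₁₂ F N θ hP).C → DagBinding.EndpointExistence (datumOfRecord₁₂ F N θ hP).C.toB12 →
        ForSmallCouplings (datumOfRecord₁₂ F N θ hP) fun g₀ => ∀ os : List (ULoop F),
          0 < (cr F θ hP g₀ os).l₀ ∧ 0 < (cr F θ hP g₀ os).vol ∧
          (∀ (K : ℕ) (t : ℝ), |t| ≤ (cr F θ hP g₀ os).l₀ →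
            T4GenFunBounds.schemeZ ((datumOfRecord₁₂ F N θ hP).scheme g₀) os ((cr F θ hP g₀ os).K₀ + K) t =
              ∑ τ ∈ (cr F θ hP g₀ os).T K, (cr F θ hP g₀ os).A K t τ) ∧
          (∀ (K : ℕ) (t : ℝ), |t| ≤ (cr F θ hP g₀ os).l₀ →
            T4GenFunBounds.schemeZ ((datumOfRecord₁₂ F N θ hP).scheme g₀) os ((cr F θ hP g₀ os).K₀ + K + 1) t =
              ∑ τ ∈ (cr F θ hP g₀ os).T K, (cr F θ hP g₀ os).B K t τ))
    (h19 : ∀ (F : T4Family) (θ : Stage12Params F N) (hP : θ.Provisos₁₂ F N), Rg F θ → θ.Admissible F N → ∀ (g₀ : ℕ → ℝ) (os : List (ULoop F)),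
      (∀ k : ℕ, RatesAt (datumOfRecord₁₂ F N θ hP) (rateCarriersOfRecord₁₂ 𝔯 F θ hP g₀ os k)) → letI := (cr F θ hP g₀ os).dec
        ∃ δ : ℕ → ℝ, NE7.Core (cr F θ hP g₀ os).l₀ (cr F θ hP g₀ os).vol (cr F θ hP g₀ os).T (cr F θ hP g₀ os).Bad
          (fun K t τ => (cr F θ hP g₀ os).A K t τ - (cr F θ hP g₀ os).shA K t τ) (fun K t τ => (cr F θ hP g₀ os).B K t τ - (cr F θ hP g₀ os).shB K t τ) δ ∧
          Summable δ)
    (F : T4Family) (θ : Stage12Params F N) (hP : θ.Provisos₁₂ F N) (hRg : Rg F θ) (hθ : θ.Admissible F N) :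
    T4ApexHybrid.HybridNE7Under (datumOfRecord₁₂ F N θ hP) (DagBinding.EndpointExistence (datumOfRecord₁₂ F N θ hP).C.toB12) :=
  (spine_keyedClass_iff_forall_keyed (Θ := fun F => Stage12Params F N) (fun θ => θ.Provisos₁₂ _ N) (fun θ => Rg _ θ ∧ θ.Admissible _ N)
      (fun θ h => datumOfRecord₁₂ _ N θ h)).mp
    (spine_of_homes₁₂On_faces cr 𝔯 Rg _ hrates (s_N27x_recOn₁₂_of_keyed cr Rg hx) h20 h21 h19) F θ hP ⟨hRg, hθ⟩

/-! ## §4 The trivial regime at the Stage-12 record class: module XXVII's conclusion with nothing read at a canonical parameter -/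

/-- **`Spine ₁₂C` FROM THE TUPLE-KEYED HOMES AT THE TRIVIAL REGIME** (§2 at `Rec := Node00.IsRecordOfRecord₁₂C F N`, `Rg := ⊤`): module XXVII's conclusion, its canonical-key edge
(rates read at `h.params`) replaced by the same-tuple all-run-lengths edge, `S_R00x` not asked.  The six rate stubs at `RRec₁₂On 𝔯 ⊤` are STRONGER than XXVII's at `RRec₁₂ 𝔯`
(n22-e `k4_rRec₁₂_of_rRec₁₂On_true`), the spine-side ones are the same (`sRec₁₂On_true_iff`), the edge is WEAKER. [bookkeeping] -/
theorem spine_rec12C_of_homes₁₂On_true (h14 : S_N14 (RRec₁₂On 𝔯 fun _ _ => True)) (h15 : S_N15 (RRec₁₂On 𝔯 fun _ _ => True))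
    (h16 : S_N16 (RRec₁₂On 𝔯 fun _ _ => True)) (h17 : S_N17 (RRec₁₂On 𝔯 fun _ _ => True)) (h18 : S_N18 (RRec₁₂On 𝔯 fun _ _ => True))
    (h22 : S_N22 (RRec₁₂On 𝔯 fun _ _ => True)) (hx' : S_N27x (fun F D w => IsRecordOfRecord₁₂C F N D w) (SRec₁₂On cr fun _ _ => True))
    (h20 : S_N20 (SRec₁₂On cr fun _ _ => True)) (h21 : S_N21 (SRec₁₂On cr fun _ _ => True))
    (h19 : ∀ (F : T4Family) (θ : Stage12Params F N) (hP : θ.Provisos₁₂ F N), θ.Admissible F N → ∀ (g₀ : ℕ → ℝ) (os : List (ULoop F)),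
      (∀ k : ℕ, RatesAt (datumOfRecord₁₂ F N θ hP) (rateCarriersOfRecord₁₂ 𝔯 F θ hP g₀ os k)) → letI := (cr F θ hP g₀ os).dec
        ∃ δ : ℕ → ℝ, NE7.Core (cr F θ hP g₀ os).l₀ (cr F θ hP g₀ os).vol (cr F θ hP g₀ os).T (cr F θ hP g₀ os).Bad
          (fun K t τ => (cr F θ hP g₀ os).A K t τ - (cr F θ hP g₀ os).shA K t τ) (fun K t τ => (cr F θ hP g₀ os).B K t τ - (cr F θ hP g₀ os).shB K t τ) δ ∧
          Summable δ) :
    Spine (N := N) fun F D w => IsRecordOfRecord₁₂C F N D w :=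
  spine_of_homes₁₂On cr 𝔯 (fun _ _ => True) _ h14 h15 h16 h17 h18 h22 hx' h20 h21 fun F θ hP _ hθ => h19 F θ hP hθ

/-! ## §5 (v1.1, append-only) N27 at node00-def-RR-2's REGIME RECORD CLASS OF RECORD `Node00.IsRecordOfRecord₁₂COn F N Rg` (`Node00/Record12DatumKeyCN`: the Stage-12 record
class with the parameter IN the regime; `forall_isRecordOfRecord₁₂COn_iff` = the θ-keyed guarded junction; guard of record `Node00.unityNondeg₁₂ N`, CN class
`Node00.IsRecordOfRecord₁₂CN`) — §3's inline regime-keyed datum class replaced by the NAMED record class; the CN instances -/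

/-- **B5 AT THE REGIME RECORD CLASS ⟺ THE θ-KEYED SENTENCE GUARDED BY `Rg`** (RR-2 `forall_isRecordOfRecord₁₂COn_iff`, family by family; B5 does not read the world).  At `N = 2`,
`Rg := Node00.unityNondeg₁₂ 2`, the right-hand side is K3′ up to its two displayed antecedents (module XXVI `spineGivenEndpointR12_iff_spine_rec12CN`). [bookkeeping] -/
theorem spine_rec12COn_iff_forall_guarded :
    Spine (N := N) (fun F D w => Node00.IsRecordOfRecord₁₂COn F N Rg D w) ↔
      ∀ (F : T4Family) (θ : Stage12Params F N) (hP : θ.Provisos₁₂ F N), Rg F θ → θ.Admissible F N →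
        T4ApexHybrid.HybridNE7Under (datumOfRecord₁₂ F N θ hP) (DagBinding.EndpointExistence (datumOfRecord₁₂ F N θ hP).C.toB12) :=
  forall_congr' fun F => Node00.forall_isRecordOfRecord₁₂COn_iff F N Rg fun D => T4ApexHybrid.HybridNE7Under D (DagBinding.EndpointExistence D.C.toB12)

/-- **ANTITONE IN THE CLASS**: B5 at every ₁₂C record gives B5 at the regime record class (`IsRecordOfRecord₁₂COn.isRecordOfRecord₁₂C`). [bookkeeping] -/
theorem spine_rec12COn_of_spine_rec12C (h : Spine (N := N) fun F D w => IsRecordOfRecord₁₂C F N D w) :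
    Spine (N := N) fun F D w => Node00.IsRecordOfRecord₁₂COn F N Rg D w :=
  spine_antitone (fun _ _ _ hR => Node00.IsRecordOfRecord₁₂COn.isRecordOfRecord₁₂C hR) h

/-- **ANTITONE IN THE REGIME**: B5 at the record class of a larger regime gives B5 at that of a smaller one (`IsRecordOfRecord₁₂COn.mono`). [bookkeeping] -/
theorem spine_rec12COn_anti {Rg Rg' : (F : T4Family) → Stage12Params F N → Prop} (hle : ∀ (F : T4Family) (θ : Stage12Params F N), Rg F θ → Rg' F θ)
    (h : Spine (N := N) fun F D w => Node00.IsRecordOfRecord₁₂COn F N Rg' D w) : Spine (N := N) fun F D w => Node00.IsRecordOfRecord₁₂COn F N Rg D w :=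
  spine_antitone (fun _ _ _ hR => Node00.IsRecordOfRecord₁₂COn.mono hle hR) h

/-- At the trivial regime the class IS ₁₂C (`isRecordOfRecord₁₂COn_true_iff`): B5 there ⟺ B5 at ₁₂C. [bookkeeping] -/
theorem spine_rec12COn_true_iff :
    (Spine (N := N) fun F D w => Node00.IsRecordOfRecord₁₂COn F N (fun _ _ => True) D w) ↔ Spine (N := N) fun F D w => IsRecordOfRecord₁₂C F N D w :=
  ⟨spine_antitone fun _ _ _ hR => Node00.isRecordOfRecord₁₂COn_true_iff.mpr hR, spine_antitone fun _ _ _ hR => Node00.isRecordOfRecord₁₂COn_true_iff.mp hR⟩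

/-- **N27x AT THE REGIME RECORD CLASS FROM THE GUARDED KEYED EXTRACTION CLAUSE** (XXIV `s_N27x_keyed_of` at the bundled key; (K1) = RR-2 `IsRecordOfRecord₁₂COn.exists_regime_tuple`).
[bookkeeping] -/
theorem s_N27x_rec12COn_of_keyed
    (hx : ∀ (F : T4Family) (θ : Stage12Params F N) (hP : θ.Provisos₁₂ F N), Rg F θ → θ.Admissible F N →
      B16.EndStatementBPrinted (datumOfRecord₁₂ F N θ hP).C → DagBinding.EndpointExistence (datumOfRecord₁₂ F N θ hP).C.toB12 →
        ForSmallCouplings (datumOfRecord₁₂ F N θ hP) fun g₀ => ∀ os : List (ULoop F),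
          0 < (cr F θ hP g₀ os).l₀ ∧ 0 < (cr F θ hP g₀ os).vol ∧
          (∀ (K : ℕ) (t : ℝ), |t| ≤ (cr F θ hP g₀ os).l₀ →
            T4GenFunBounds.schemeZ ((datumOfRecord₁₂ F N θ hP).scheme g₀) os ((cr F θ hP g₀ os).K₀ + K) t =
              ∑ τ ∈ (cr F θ hP g₀ os).T K, (cr F θ hP g₀ os).A K t τ) ∧
          (∀ (K : ℕ) (t : ℝ), |t| ≤ (cr F θ hP g₀ os).l₀ →
            T4GenFunBounds.schemeZ ((datumOfRecord₁₂ F N θ hP).scheme g₀) os ((cr F θ hP g₀ os).K₀ + K + 1) t =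
              ∑ τ ∈ (cr F θ hP g₀ os).T K, (cr F θ hP g₀ os).B K t τ)) :
    S_N27x (fun F D w => Node00.IsRecordOfRecord₁₂COn F N Rg D w) (SRec₁₂On cr Rg) :=
  s_N27x_keyed_of (Θ := fun F => Stage12Params F N) (fun θ => θ.Provisos₁₂ _ N) (fun θ => Rg _ θ ∧ θ.Admissible _ N) (fun θ h => datumOfRecord₁₂ _ N θ h) _
    (SRec₁₂On cr Rg) (fun θ h => cr _ θ h)
    (fun _ _ _ hR => by
      obtain ⟨θ, hP, hRg, hθ, hD⟩ := Node00.IsRecordOfRecord₁₂COn.exists_regime_tuple hR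
      exact ⟨θ, hP, ⟨hRg, hθ⟩, hD⟩)
    (fun _ D g₀ os S => sRec₁₂On_iff_bundled cr Rg D g₀ os S) fun F θ hP hA => hx F θ hP hA.1 hA.2

/-- **R00x AT THE REGIME PAIR, BY NAME** (n22-e `s_R00x_rRec₁₂On_of_regime` ∘ RR-2 `IsRecordOfRecord₁₂COn.exists_regime_tuple`, ONE application): the rate carriers of record
exist under the pins at every record of the regime class — LOCATED (objects residual), not content; recorded so that XIV's seven-stub road is also available at the regime pair.
[bookkeeping] -/
theorem s_R00x_rec12COn_rRec₁₂On : S_R00x (fun F D w => Node00.IsRecordOfRecord₁₂COn F N Rg D w) (RRec₁₂On 𝔯 Rg) :=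
  s_R00x_rRec₁₂On_of_regime 𝔯 Rg fun _ _ _ hR => Node00.IsRecordOfRecord₁₂COn.exists_regime_tuple hR

/-- **N27 = B5 AT THE REGIME RECORD CLASS FROM THE STUB INSTANCES OF THE TWO REGIME HOMES, THE GUARDED KEYED EXTRACTION CLAUSE AND THE SAME-TUPLE EDGE** (§2
`spine_of_homes₁₂On` at `Rec := IsRecordOfRecord₁₂COn F N Rg` with `s_N27x_rec12COn_of_keyed`; `S_R00x` not asked).  Every hypothesis 0∕1 today. [bookkeeping] -/
theorem spine_rec12COn_of_homes₁₂On (h14 : S_N14 (RRec₁₂On 𝔯 Rg)) (h15 : S_N15 (RRec₁₂On 𝔯 Rg)) (h16 : S_N16 (RRec₁₂On 𝔯 Rg)) (h17 : S_N17 (RRec₁₂On 𝔯 Rg))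
    (h18 : S_N18 (RRec₁₂On 𝔯 Rg)) (h22 : S_N22 (RRec₁₂On 𝔯 Rg)) (h20 : S_N20 (SRec₁₂On cr Rg)) (h21 : S_N21 (SRec₁₂On cr Rg))
    (hx : ∀ (F : T4Family) (θ : Stage12Params F N) (hP : θ.Provisos₁₂ F N), Rg F θ → θ.Admissible F N →
      B16.EndStatementBPrinted (datumOfRecord₁₂ F N θ hP).C → DagBinding.EndpointExistence (datumOfRecord₁₂ F N θ hP).C.toB12 →
        ForSmallCouplings (datumOfRecord₁₂ F N θ hP) fun g₀ => ∀ os : List (ULoop F),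
          0 < (cr F θ hP g₀ os).l₀ ∧ 0 < (cr F θ hP g₀ os).vol ∧
          (∀ (K : ℕ) (t : ℝ), |t| ≤ (cr F θ hP g₀ os).l₀ →
            T4GenFunBounds.schemeZ ((datumOfRecord₁₂ F N θ hP).scheme g₀) os ((cr F θ hP g₀ os).K₀ + K) t =
              ∑ τ ∈ (cr F θ hP g₀ os).T K, (cr F θ hP g₀ os).A K t τ) ∧
          (∀ (K : ℕ) (t : ℝ), |t| ≤ (cr F θ hP g₀ os).l₀ →
            T4GenFunBounds.schemeZ ((datumOfRecord₁₂ F N θ hP).scheme g₀) os ((cr F θ hP g₀ os).K₀ + K + 1) t =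
              ∑ τ ∈ (cr F θ hP g₀ os).T K, (cr F θ hP g₀ os).B K t τ))
    (h19 : ∀ (F : T4Family) (θ : Stage12Params F N) (hP : θ.Provisos₁₂ F N), Rg F θ → θ.Admissible F N → ∀ (g₀ : ℕ → ℝ) (os : List (ULoop F)),
      (∀ k : ℕ, RatesAt (datumOfRecord₁₂ F N θ hP) (rateCarriersOfRecord₁₂ 𝔯 F θ hP g₀ os k)) → letI := (cr F θ hP g₀ os).dec
        ∃ δ : ℕ → ℝ, NE7.Core (cr F θ hP g₀ os).l₀ (cr F θ hP g₀ os).vol (cr F θ hP g₀ os).T (cr F θ hP g₀ os).Bad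
          (fun K t τ => (cr F θ hP g₀ os).A K t τ - (cr F θ hP g₀ os).shA K t τ) (fun K t τ => (cr F θ hP g₀ os).B K t τ - (cr F θ hP g₀ os).shB K t τ) δ ∧
          Summable δ) :
    Spine (N := N) fun F D w => Node00.IsRecordOfRecord₁₂COn F N Rg D w :=
  spine_of_homes₁₂On cr 𝔯 Rg _ h14 h15 h16 h17 h18 h22 (s_N27x_rec12COn_of_keyed cr Rg hx) h20 h21 h19

/-- **B5 AT THE CN RECORD CLASS ⟺ THE θ-KEYED SENTENCE AT THE GUARD OF RECORD** «`(θ.ZtUnity F N ∧ θ.SlotsNondegenerate) → θ.Admissible F N → HybridNE7Under (datumOfRecord₁₂ F N θ hP) END`»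
(`spine_rec12COn_iff_forall_guarded` at `Rg := Node00.unityNondeg₁₂ N`; RR-2 `forall_isRecordOfRecord₁₂CN_iff`). [bookkeeping] -/
theorem spine_rec12CN_iff_forall_guarded :
    Spine (N := N) (fun F D w => Node00.IsRecordOfRecord₁₂CN F N D w) ↔
      ∀ (F : T4Family) (θ : Stage12Params F N) (hP : θ.Provisos₁₂ F N), (θ.ZtUnity F N ∧ θ.SlotsNondegenerate) → θ.Admissible F N →
        T4ApexHybrid.HybridNE7Under (datumOfRecord₁₂ F N θ hP) (DagBinding.EndpointExistence (datumOfRecord₁₂ F N θ hP).C.toB12) :=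
  spine_rec12COn_iff_forall_guarded (Node00.unityNondeg₁₂ N)

/-- **N27 = B5 AT THE CN RECORD CLASS FROM THE STUBS AT THE GUARD-RESTRICTED HOMES** (`spine_rec12COn_of_homes₁₂On` at `Rg := Node00.unityNondeg₁₂ N`): the six K4 stubs at
`RRec₁₂On 𝔯 (unityNondeg₁₂ N)`, N20 ∕ N21 at `SRec₁₂On cr (unityNondeg₁₂ N)`, the extraction clause and the same-tuple edge — every one asked only of admissible tuples WITH print's
partition of unity and non-degenerate present slots.  Every hypothesis 0∕1 today. [bookkeeping] -/
theorem spine_rec12CN_of_homes₁₂On (h14 : S_N14 (RRec₁₂On 𝔯 (Node00.unityNondeg₁₂ N))) (h15 : S_N15 (RRec₁₂On 𝔯 (Node00.unityNondeg₁₂ N)))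
    (h16 : S_N16 (RRec₁₂On 𝔯 (Node00.unityNondeg₁₂ N))) (h17 : S_N17 (RRec₁₂On 𝔯 (Node00.unityNondeg₁₂ N))) (h18 : S_N18 (RRec₁₂On 𝔯 (Node00.unityNondeg₁₂ N)))
    (h22 : S_N22 (RRec₁₂On 𝔯 (Node00.unityNondeg₁₂ N))) (h20 : S_N20 (SRec₁₂On cr (Node00.unityNondeg₁₂ N))) (h21 : S_N21 (SRec₁₂On cr (Node00.unityNondeg₁₂ N)))
    (hx : ∀ (F : T4Family) (θ : Stage12Params F N) (hP : θ.Provisos₁₂ F N), (θ.ZtUnity F N ∧ θ.SlotsNondegenerate) → θ.Admissible F N →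
      B16.EndStatementBPrinted (datumOfRecord₁₂ F N θ hP).C → DagBinding.EndpointExistence (datumOfRecord₁₂ F N θ hP).C.toB12 →
        ForSmallCouplings (datumOfRecord₁₂ F N θ hP) fun g₀ => ∀ os : List (ULoop F),
          0 < (cr F θ hP g₀ os).l₀ ∧ 0 < (cr F θ hP g₀ os).vol ∧
          (∀ (K : ℕ) (t : ℝ), |t| ≤ (cr F θ hP g₀ os).l₀ →
            T4GenFunBounds.schemeZ ((datumOfRecord₁₂ F N θ hP).scheme g₀) os ((cr F θ hP g₀ os).K₀ + K) t =
              ∑ τ ∈ (cr F θ hP g₀ os).T K, (cr F θ hP g₀ os).A K t τ) ∧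
          (∀ (K : ℕ) (t : ℝ), |t| ≤ (cr F θ hP g₀ os).l₀ →
            T4GenFunBounds.schemeZ ((datumOfRecord₁₂ F N θ hP).scheme g₀) os ((cr F θ hP g₀ os).K₀ + K + 1) t =
              ∑ τ ∈ (cr F θ hP g₀ os).T K, (cr F θ hP g₀ os).B K t τ))
    (h19 : ∀ (F : T4Family) (θ : Stage12Params F N) (hP : θ.Provisos₁₂ F N), (θ.ZtUnity F N ∧ θ.SlotsNondegenerate) → θ.Admissible F N →
      ∀ (g₀ : ℕ → ℝ) (os : List (ULoop F)), (∀ k : ℕ, RatesAt (datumOfRecord₁₂ F N θ hP) (rateCarriersOfRecord₁₂ 𝔯 F θ hP g₀ os k)) → letI := (cr F θ hP g₀ os).dec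
        ∃ δ : ℕ → ℝ, NE7.Core (cr F θ hP g₀ os).l₀ (cr F θ hP g₀ os).vol (cr F θ hP g₀ os).T (cr F θ hP g₀ os).Bad
          (fun K t τ => (cr F θ hP g₀ os).A K t τ - (cr F θ hP g₀ os).shA K t τ) (fun K t τ => (cr F θ hP g₀ os).B K t τ - (cr F θ hP g₀ os).shB K t τ) δ ∧
          Summable δ) :
    Spine (N := N) fun F D w => Node00.IsRecordOfRecord₁₂CN F N D w :=
  spine_rec12COn_of_homes₁₂On cr 𝔯 (Node00.unityNondeg₁₂ N) h14 h15 h16 h17 h18 h22 h20 h21 hx h19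

end Summit.QuantumFields.YangMills.Theorems.BalabanUVNodesN27SpineRecord
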